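import Summits.CriticalPhenomena.PercolationContinuityZ3.Theorems.PercNearOneGluingNoHeavyLowerTailThresholdRABHalfCube
import Mathlib.Combinatorics.SetFamily.LYM

/-!
# `NoHeavyLowerTail` (crux stmt-CriticalPhenomena-4575), lane prim-ineq-gen-4 (gen 18): the STRICT fibre lemma (RAB_k) for every `k`

Support file (`--supports stmt-CriticalPhenomena-4575`; memo `run/shared/lean/prim/prim-ineq-gen-4/PROOFS-RAB-ALL-K-g18.md`, Theorem 2).
No definitions, no `sorry`, standard axioms.

In the down-set language of `…ThresholdRAB` (complementation inside the ground finset `s`): for lower sets `D, E ⊆ 𝒫(s)` with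
`2k ≤ #s + 1` (i.e. `#s ≥ 2k − 1`), `s ∉ D ∩ E`, and `D ∩ E` containing a member `v` with `#s + 1 ≤ #v + k` (a "large" common member;
in the memo's up-set language: `∅ ∉ A ∩ B` and `A ∩ B` contains a set of size `≤ k − 1`), the functional `Ψ_k` is at least `1`
(`rab_strict`, `rab_strict_counting`).  This is the strictness unit that lets the large fibres of the spectator certificate absorb the
re-distributed small-set charges (memo Theorem 3 / §8b).

Proof: base `#s + 1 = 2k` by the mirror inequality `#C_{y−i} ≤ #C_i` for lower sets (densities of a lower set are non-increasing — Mathlib's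
local LYM inequality — transported from a `Fintype` to `𝒫(s)`), together with `#C_0 = 1`, `#C_y = 0`; step by the section inequality
`psi_section` at a point of the large common member, plus `rab` for the other section.
-/

namespace Summit.CriticalPhenomena.PercolationContinuityZ3.Theorems.ThresholdRAB

open Finset
open scoped FinsetFamily

/-! ### Mirror inequality for lower sets: `#L_{y-i} ≤ #L_i` -/

section Mirror

variable {β : Type*} [DecidableEq β] [Fintype β]

omit [Fintype β] in
/-- The shadow of a slice of a lower set lies in the slice below. [folklore] -/
theorem shadow_slice_subset_of_isLowerSet (L : Finset (Finset β)) (hL : IsLowerSet (L : Set (Finset β))) (r : ℕ) :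
    ∂ (L # (r + 1)) ⊆ L # r := by
  intro t ht
  rw [mem_shadow_iff] at ht
  obtain ⟨u, hu, a, ha, rfl⟩ := ht
  rw [mem_slice] at hu ⊢
  exact ⟨hL (erase_subset a u) hu.1, by rw [card_erase_of_mem ha, hu.2]; rfl⟩

/-- Densities of a lower set are non-increasing: `#L_{r+1} / C(y,r+1) ≤ #L_r / C(y,r)`. [folklore; local LYM] -/
theorem density_succ_le (L : Finset (Finset β)) (hL : IsLowerSet (L : Set (Finset β))) (r : ℕ) :
    (#(L # (r + 1)) : ℚ) / (Fintype.card β).choose (r + 1) ≤ (#(L # r) : ℚ) / (Fintype.card β).choose r := by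
  have h1 := Finset.local_lubell_yamamoto_meshalkin_inequality_div (𝕜 := ℚ) (Nat.succ_ne_zero r)
    (sized_slice (𝒜 := L) (r := r + 1))
  simp only [Nat.succ_eq_add_one, Nat.add_sub_cancel] at h1
  refine h1.trans ?_
  gcongr
  exact shadow_slice_subset_of_isLowerSet L hL r

/-- Densities of a lower set are non-increasing along any gap. [folklore] -/
theorem density_le_of_le (L : Finset (Finset β)) (hL : IsLowerSet (L : Set (Finset β))) (r d : ℕ) :
    (#(L # (r + d)) : ℚ) / (Fintype.card β).choose (r + d) ≤ (#(L # r) : ℚ) / (Fintype.card β).choose r := by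
  induction d with
  | zero => simp
  | succ d ih => exact (density_succ_le L hL (r + d)).trans ih

/-- **Mirror inequality**: a lower set of subsets of a `y`-set has `#L_{y−i} ≤ #L_i` for `2i ≤ y`. [folklore] -/
theorem card_slice_mirror_le (L : Finset (Finset β)) (hL : IsLowerSet (L : Set (Finset β))) {i : ℕ}
    (hi : 2 * i ≤ Fintype.card β) : #(L # (Fintype.card β - i)) ≤ #(L # i) := by
  set y := Fintype.card β with hy
  have h := density_le_of_le L hL i (y - 2 * i)
  rw [show i + (y - 2 * i) = y - i by omega, Nat.choose_symm (by omega : i ≤ y)] at h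
  have hc : (0 : ℚ) < (y.choose i : ℚ) := by exact_mod_cast Nat.choose_pos (by omega : i ≤ y)
  rw [div_le_div_iff_of_pos_right hc] at h
  exact_mod_cast h

end Mirror

/-! ### The base case `#s + 1 = 2k` inside a ground finset -/

section Base

variable {α : Type*} [DecidableEq α]

/-- Mirror inequality inside a ground finset `t`: a lower set `C ⊆ 𝒫(t)` has `#{v ∈ C : #v = #t − i} ≤ #{v ∈ C : #v = i}` for `2i ≤ #t`
(transport of `card_slice_mirror_le` to the subtype of `t`). [folklore] -/
theorem card_level_mirror_le (t : Finset α) (C : Finset (Finset α)) (hC : IsLowerSet (C : Set (Finset α)))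
    (hCt : ∀ u ∈ C, u ⊆ t) {i : ℕ} (hi : 2 * i ≤ #t) :
    #(C.filter fun v => #v = #t - i) ≤ #(C.filter fun v => #v = i) := by
  set f : Finset α → Finset {x // x ∈ t} := fun z => z.subtype (· ∈ t) with hf
  have hback : ∀ z, z ⊆ t → (f z).map (Function.Embedding.subtype _) = z := fun z hz =>
    subtype_map_of_mem fun x hx => hz hx
  have hcard : ∀ z, z ⊆ t → #(f z) = #z := by
    intro z hz; rw [← card_map (Function.Embedding.subtype _), hback z hz]
  have hinj : Set.InjOn f C := by
    intro z hz w hw h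
    rw [← hback z (hCt z hz), ← hback w (hCt w hw)]
    exact congrArg _ h
  set C' := C.image f with hC'
  have hC'low : IsLowerSet (C' : Set (Finset {x // x ∈ t})) := by
    intro y y' hy' hy
    rw [mem_coe, hC', mem_image] at hy ⊢
    obtain ⟨z, hz, rfl⟩ := hy
    refine ⟨y'.map (Function.Embedding.subtype _), hC ?_ hz, ?_⟩
    · show y'.map (Function.Embedding.subtype _) ≤ z
      rw [← hback z (hCt z hz)]; exact map_subset_map.2 hy'
    · ext b; simp only [hf, mem_subtype, mem_map, Function.Embedding.coe_subtype]
      constructor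
      · rintro ⟨b', hb', h⟩; rwa [← Subtype.ext h]
      · intro hb; exact ⟨b, hb, rfl⟩
  have hcount : ∀ j : ℕ, #(C' # j) = #(C.filter fun z => #z = j) := by
    intro j
    rw [Finset.slice, hC', filter_image,
      card_image_of_injOn (fun z hz w hw h => hinj (mem_filter.1 hz).1 (mem_filter.1 hw).1 h)]
    congr 1; ext z; simp only [mem_filter]
    exact ⟨fun ⟨hz, h⟩ => ⟨hz, by rwa [hcard z (hCt z hz)] at h⟩, fun ⟨hz, h⟩ => ⟨hz, by rwa [hcard z (hCt z hz)]⟩⟩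
  have hβ : Fintype.card {x // x ∈ t} = #t := Fintype.card_coe t
  have key := card_slice_mirror_le C' hC'low (i := i) (by rw [hβ]; exact hi)
  rw [hβ, hcount, hcount] at key
  exact key

/-- **Base case** (`#s + 1 = 2k`): a lower set `C ⊆ 𝒫(s)` with `s ∉ C` and a member of size `≥ k` has
`#{v ∈ C : k ≤ #v} + 1 ≤ #{v ∈ C : #v + k ≤ #s}`. [this work] -/
theorem base_strict (s : Finset α) (k : ℕ) (hk : #s + 1 = 2 * k) (C : Finset (Finset α)) (hC : IsLowerSet (C : Set (Finset α)))
    (hCs : ∀ u ∈ C, u ⊆ s) (hsC : s ∉ C) (hv : ∃ v ∈ C, k ≤ #v) :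
    #(C.filter fun v => k ≤ #v) + 1 ≤ #(C.filter fun v => #v + k ≤ #s) := by
  obtain ⟨v₀, hv₀, hv₀k⟩ := hv
  have hk1 : 1 ≤ k := by omega
  have hempty : (∅ : Finset α) ∈ C := hC (empty_subset v₀) hv₀
  -- members have size < #s
  have hlt : ∀ u ∈ C, #u < #s := by
    intro u hu
    have hus := hCs u hu
    rcases (card_le_card hus).lt_or_eq with h | h
    · exact h
    · exact absurd ((eq_of_subset_of_card_le hus h.ge) ▸ hu) hsC
  -- upper part: levels #s - i for i ∈ [1, k-1]
  have hup : #(C.filter fun v => k ≤ #v) = ∑ i ∈ Ico 1 k, #(C.filter fun v => #v = #s - i) := by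
    have h1 : (C.filter fun v => k ≤ #v) = C.filter fun v => k ≤ #v ∧ #v < #s := by
      ext v; simp only [mem_filter]; exact ⟨fun h => ⟨h.1, h.2, hlt v h.1⟩, fun h => ⟨h.1, h.2.1⟩⟩
    rw [h1, ← sum_card_level_eq C k #s]
    refine sum_bij (fun j _ => #s - j) (fun j hj => ?_) (fun j hj j' hj' h => ?_) (fun i hi => ?_) (fun j hj => ?_)
    · rw [mem_Ico] at hj ⊢; omega
    · rw [mem_Ico] at hj hj'; omega
    · rw [mem_Ico] at hi; exact ⟨#s - i, by rw [mem_Ico]; omega, by omega⟩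
    · rw [mem_Ico] at hj; congr 1; ext v; simp only [mem_filter]; constructor
      · rintro ⟨h1, h2⟩; exact ⟨h1, by omega⟩
      · rintro ⟨h1, h2⟩; exact ⟨h1, by omega⟩
  -- lower part: level 0 plus levels i ∈ [1, k-1]
  have hlow : #(C.filter fun v => #v + k ≤ #s) = 1 + ∑ i ∈ Ico 1 k, #(C.filter fun v => #v = i) := by
    have h1 : (C.filter fun v => #v + k ≤ #s) = {∅} ∪ C.filter fun v => 1 ≤ #v ∧ #v < k := by
      ext v; simp only [mem_filter, mem_union, mem_singleton]
      constructor
      · rintro ⟨hv, h⟩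
        by_cases h0 : v = ∅
        · exact Or.inl h0
        · exact Or.inr ⟨hv, by rw [Nat.one_le_iff_ne_zero]; exact fun h' => h0 (card_eq_zero.1 h'), by omega⟩
      · rintro (rfl | ⟨hv, _, h⟩)
        · exact ⟨hempty, by rw [card_empty]; omega⟩
        · exact ⟨hv, by omega⟩
    rw [h1, card_union_of_disjoint, card_singleton, sum_card_level_eq C 1 k]
    rw [disjoint_singleton_left, mem_filter, card_empty]; omega
  rw [hup, hlow]
  have hle : ∑ i ∈ Ico 1 k, #(C.filter fun v => #v = #s - i) ≤ ∑ i ∈ Ico 1 k, #(C.filter fun v => #v = i) :=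
    sum_le_sum fun i hi => by
      rw [mem_Ico] at hi
      exact card_level_mirror_le s C hC hCs (i := i) (by omega)
  omega

end Base

/-! ### The strict fibre lemma -/

section Strict

variable {α : Type*} [DecidableEq α]

/-- **Strict (RAB_k)** (memo Theorem 2, down-set form, integer-sum form).  For lower sets `D, E ⊆ 𝒫(s)`, `2k ≤ #s + 1`, `s ∉ D ∩ E`,
and a common member `v` with `#s + 1 ≤ #v + k`:
`1 ≤ Σ_{v ∈ D∩E} ([#v + k ≤ #s] − [#s < #v + k]) − Σ_{z ∈ D, s\z ∈ E} ([k ≤ #z] + [#z + k ≤ #s] − 1)`. [this work] -/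
theorem rab_strict (d : ℕ) : ∀ (s : Finset α) (k : ℕ) (D E : Finset (Finset α)), IsLowerSet (D : Set (Finset α)) →
    IsLowerSet (E : Set (Finset α)) → (∀ t ∈ D, t ⊆ s) → (∀ t ∈ E, t ⊆ s) → #s + 1 = 2 * k + d → s ∉ D ∩ E →
    (∃ v ∈ D ∩ E, #s + 1 ≤ #v + k) →
    1 ≤ (∑ v ∈ D ∩ E, (if #v + k ≤ #s then (1 : ℤ) else -1))
          - ∑ z ∈ D with s \ z ∈ E, ((if k ≤ #z then 1 else 0) + (if #z + k ≤ #s then 1 else 0) - 1 : ℤ) := by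
  induction d with
  | zero =>
    intro s k D E hD hE hDs hEs hsk hs hv
    -- the cross weights vanish; the diagonal is a difference of two counts
    have hcross : ∑ z ∈ D with s \ z ∈ E, ((if k ≤ #z then 1 else 0) + (if #z + k ≤ #s then 1 else 0) - 1 : ℤ) = 0 := by
      refine sum_eq_zero fun z _ => ?_
      split_ifs <;> omega
    have hdiag : ∑ v ∈ D ∩ E, (if #v + k ≤ #s then (1 : ℤ) else -1)
        = (#((D ∩ E).filter fun v => #v + k ≤ #s) : ℤ) - #((D ∩ E).filter fun v => k ≤ #v) := by
      rw [natCast_card_filter, natCast_card_filter, ← sum_sub_distrib]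
      refine sum_congr rfl fun v _ => ?_
      split_ifs <;> omega
    have hCl : IsLowerSet ((D ∩ E : Finset (Finset α)) : Set (Finset α)) := by rw [coe_inter]; exact hD.inter hE
    obtain ⟨v, hv, hvk⟩ := hv
    have hb := base_strict s k (by omega) (D ∩ E) hCl (fun u hu => hDs u (mem_inter.1 hu).1) hs ⟨v, hv, by omega⟩
    rw [hcross, hdiag]
    omega
  | succ d ih =>
    intro s k D E hD hE hDs hEs hsk hs hv
    obtain ⟨v, hv, hvk⟩ := hv
    -- a point of the large common member
    have hvne : v.Nonempty := by
      rw [nonempty_iff_ne_empty]; rintro rfl; rw [card_empty] at hvk; omega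
    obtain ⟨e, hev⟩ := hvne
    have hes : e ∈ s := hDs v (mem_inter.1 hv).1 hev
    set s' := s.erase e with hs'
    have hins : insert e s' = s := insert_erase hes
    have hes' : e ∉ s' := notMem_erase e s
    have hspos : 0 < #s := card_pos.2 ⟨e, hes⟩
    have hcs' : #s' + 1 = #s := by rw [hs', card_erase_of_mem hes]; omega
    have hDs' : ∀ t ∈ D, t ⊆ insert e s' := by rw [hins]; exact hDs
    have hEs' : ∀ t ∈ E, t ⊆ insert e s' := by rw [hins]; exact hEs
    -- section inequality at e
    have hsec := psi_section hes' hD hE hDs' k (by omega)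
    rw [hins] at hsec
    -- induction hypothesis on the member sections
    have h1 := ih s' k (D.memberSubfamily e) (E.memberSubfamily e) hD.memberSubfamily hE.memberSubfamily
      (fun t ht => subset_of_mem_memberSubfamily hDs' ht) (fun t ht => subset_of_mem_memberSubfamily hEs' ht) (by omega)
      (by
        rw [mem_inter, mem_memberSubfamily, mem_memberSubfamily, hins]
        intro h; exact hs (mem_inter.2 ⟨h.1.1, h.2.1⟩))
      ⟨v.erase e, by
        rw [mem_inter, mem_memberSubfamily, mem_memberSubfamily, insert_erase hev]
        exact ⟨⟨(mem_inter.1 hv).1, notMem_erase e v⟩, ⟨(mem_inter.1 hv).2, notMem_erase e v⟩⟩, by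
        rw [card_erase_of_mem hev]; omega⟩
    -- plain (RAB_{k-1}) on the non-member sections
    have h2 := rab s' (k - 1) (D.nonMemberSubfamily e) (E.nonMemberSubfamily e) hD.nonMemberSubfamily hE.nonMemberSubfamily
      (fun t ht => subset_of_mem_nonMemberSubfamily hDs' ht) (fun t ht => subset_of_mem_nonMemberSubfamily hEs' ht) (by omega)
    linarith

/-- **Strict (RAB_k), counting form** (memo Theorem 2): under the hypotheses of `rab_strict`, with `X = {z ∈ D : s \ z ∈ E}`,
`#{z ∈ X : k ≤ #z} + #{z ∈ X : #z + k ≤ #s} + #{v ∈ D∩E : #s < #v + k} + 1 ≤ #X + #{v ∈ D∩E : #v + k ≤ #s}`. [this work] -/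
theorem rab_strict_counting (s : Finset α) (k : ℕ) (D E : Finset (Finset α)) (hD : IsLowerSet (D : Set (Finset α)))
    (hE : IsLowerSet (E : Set (Finset α))) (hDs : ∀ t ∈ D, t ⊆ s) (hEs : ∀ t ∈ E, t ⊆ s) (hk : 2 * k ≤ #s + 1)
    (hs : s ∉ D ∩ E) (hv : ∃ v ∈ D ∩ E, #s + 1 ≤ #v + k) :
    #((D.filter fun z => s \ z ∈ E).filter fun z => k ≤ #z)
        + #((D.filter fun z => s \ z ∈ E).filter fun z => #z + k ≤ #s)
        + #((D ∩ E).filter fun v => #s < #v + k) + 1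
      ≤ #(D.filter fun z => s \ z ∈ E) + #((D ∩ E).filter fun v => #v + k ≤ #s) := by
  have h := rab_strict (#s + 1 - 2 * k) s k D E hD hE hDs hEs (by omega) hs hv
  have hdiag : ∑ v ∈ D ∩ E, (if #v + k ≤ #s then (1 : ℤ) else -1)
      = (#((D ∩ E).filter fun v => #v + k ≤ #s) : ℤ) - #((D ∩ E).filter fun v => #s < #v + k) := by
    rw [natCast_card_filter, natCast_card_filter, ← sum_sub_distrib]
    refine sum_congr rfl fun v _ => ?_
    split_ifs <;> omega
  have hcross : ∑ z ∈ D with s \ z ∈ E, ((if k ≤ #z then 1 else 0) + (if #z + k ≤ #s then 1 else 0) - 1 : ℤ)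
      = (#((D.filter fun z => s \ z ∈ E).filter fun z => k ≤ #z) : ℤ)
        + #((D.filter fun z => s \ z ∈ E).filter fun z => #z + k ≤ #s) - #(D.filter fun z => s \ z ∈ E) := by
    rw [natCast_card_filter, natCast_card_filter, card_eq_sum_ones (D.filter fun z => s \ z ∈ E),
      sum_sub_distrib, sum_add_distrib]
    push_cast
    rfl
  rw [hdiag, hcross] at h
  omega

end Strict

end Summit.CriticalPhenomena.PercolationContinuityZ3.Theorems.ThresholdRAB
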